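import Mathlib.FieldTheory.Normal.Closure
import Mathlib.FieldTheory.Galois.Basic
import Mathlib.FieldTheory.IsAlgClosed.Basic
import Mathlib.FieldTheory.Perfect
import Mathlib.NumberTheory.NumberField.Basic
import Mathlib.Analysis.Complex.Polynomial.Basic
import Mathlib.Algebra.Algebra.Hom.Rat
import HarnessLib

/-!
# A Galois compositum INSIDE `ℂ` of finitely many complex-embedded number fields over a common base embedding

Topic `Literature/FieldTheory/Galois`; namespace `Literature.FieldTheory.Galois`.  THEOREMS ONLY (no definition, no named fact, no instance,
no notation, no `sorry`).  Cell `hodgecm-mathlib`, FLOOR 0, P6 «MOD programme» (crux hLiu418 = stmt-HodgeConjecture-24832, `--supports`), line «L4» ∕ GEN: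
the brick behind GEN՚s assembly `gen_of_parts` (A-p18 (g32) 2026-09-02T05:15:48Z, «`Fi` := a Galois compositum INSIDE ℂ of the `τ₀ᵢ(Fi₀ᵢ)` over `ι₁`
with `τE`, `jᵢ` (GEN organ, M)»): the E-line head `pelWitnessE_of_line` delivers, PER CM FRAME `Φᵢ`, a slice number field `Fi₀ᵢ` with a complex embedding
`τ₀ᵢ` over `ι₁ : F →+* ℂ` and a witness over EVERY Galois `Fi ∕ F` receiving `Fi₀ᵢ` compatibly (`τE ∘ jᵢ = τ₀ᵢ`); GEN՚s letter `RecordGENChoicesCofinal` binds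
ONE Galois slice field `Fi` (`NumberField`, `Algebra F`, `FiniteDimensional F`, `IsGalois F`, `τE` over `ι₁`) for a FINITE family of frames — so it needs:

* §1 **`exists_numberField_isGalois_comp_eq`** — for a number field `F` with `ι₁ : F →+* ℂ` and finitely many number fields `Kᵢ` over `F` with complex
  embeddings `τᵢ : Kᵢ →+* ℂ` over `ι₁` (`τᵢ ∘ algebraMap = ι₁`), there is a number field `L ⊇ F`, finite and GALOIS over `F`, with a complex embedding
  `τL` over `ι₁` and `F`-algebra maps `jᵢ : Kᵢ →ₐ[F] L` with `τL ∘ jᵢ = τᵢ`.  Construction (Mathlib only): `L :=` the normal closure over `ℚ`, INSIDE `ℂ`, of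
  the subfield generated by `ι₁(F)` and the `τᵢ(Kᵢ)` (`normalClosure ℚ M ℂ`; normal because `ℂ` is algebraically closed —
  `Algebra.IsAlgebraic.isNormalClosure_normalClosure`; finite because the family is finite; separable in characteristic `0`), `Algebra F L` and `jᵢ` the
  corestrictions of `ι₁`, `τᵢ`, and `τL` the inclusion `L ⊆ ℂ` — so both compatibilities hold on the nose.
* §1 **`exists_numberField_isGalois_rat_comp_eq`** — the same `L` recorded with `IsGalois ℚ L` as well (it IS a normal closure over `ℚ`).
The tree՚s ★ `Resolution.GaloisSplittingField.exists_isGalois_splits_minpoly` (de Jong 4.16) gives an ABSTRACT finite Galois extension receiving the `Kᵢ`,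
without compatibility with prescribed complex embeddings; the present file is the embedded version GEN consumes.  Budgets: default heartbeats.

References: S. Lang, *Algebra*, GTM 211 (2002), Ch. V §3 (normal extensions; the normal closure of a finite extension inside an algebraically
closed field is finite) and Ch. VI §1 Thm. 1.10–1.12 (composita of Galois extensions) [Lang2002].
HC_CM is proved only modulo the printed citations (2 remaining named inputs hLiu418 24832, h413 24833) until rung 0 closes — count-neutral.
-/

noncomputable section

namespace Literature.FieldTheory.Galois

open IntermediateField

/-- **A finite Galois number field over `F`, INSIDE `ℂ`, receiving finitely many complex-embedded number fields compatibly with their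
embeddings.**  For a number field `F` with a complex embedding `ι₁`, a finite family of number fields `Kᵢ ∕ F` and complex embeddings
`τᵢ : Kᵢ →+* ℂ` extending `ι₁`, there is a number field `L`, an `F`-algebra, finite-dimensional and Galois over `F`, with a complex
embedding `τL` extending `ι₁` and `F`-algebra maps `jᵢ : Kᵢ →ₐ[F] L` with `τL ∘ jᵢ = τᵢ` for every `i` (`L` = the normal closure over `ℚ`
inside `ℂ` of the compositum `ι₁(F) · ∏ᵢ τᵢ(Kᵢ)`). [cite: Lang2002, Ch. V §3 and Ch. VI §1 Thm. 1.12 (normal closure; compositum of Galois extensions)] -/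
theorem exists_numberField_isGalois_comp_eq (F : Type) [Field F] [NumberField F] (ι₁ : F →+* ℂ)
    {ι : Type} [Finite ι] (K : ι → Type) [∀ i, Field (K i)] [∀ i, NumberField (K i)] [∀ i, Algebra F (K i)]
    (τ : ∀ i, K i →+* ℂ) (hτ : ∀ i, (τ i).comp (algebraMap F (K i)) = ι₁) :
    ∃ (L : Type) (_ : Field L) (_ : NumberField L) (_ : Algebra F L) (_ : FiniteDimensional F L) (_ : IsGalois F L)
      (τL : L →+* ℂ), τL.comp (algebraMap F L) = ι₁ ∧
        ∃ j : ∀ i, K i →ₐ[F] L, ∀ i, τL.comp (j i : K i →+* L) = τ i := by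
  classical
  -- §a the finite subfield `M ⊆ ℂ` generated over `ℚ` by `ι₁(F)` and the `τᵢ(Kᵢ)`, and its normal closure `L` inside `ℂ`
  let f₀ : F →ₐ[ℚ] ℂ := ι₁.toRatAlgHom
  let f : ∀ i, K i →ₐ[ℚ] ℂ := fun i => (τ i).toRatAlgHom
  let M : IntermediateField ℚ ℂ := f₀.fieldRange ⊔ ⨆ i, (f i).fieldRange
  haveI h₀ : FiniteDimensional ℚ f₀.fieldRange := LinearEquiv.finiteDimensional f₀.equivFieldRange.toLinearEquiv
  haveI hᵢ : ∀ i, FiniteDimensional ℚ (f i).fieldRange := fun i =>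
    LinearEquiv.finiteDimensional (f i).equivFieldRange.toLinearEquiv
  haveI : FiniteDimensional ℚ (⨆ i, (f i).fieldRange : IntermediateField ℚ ℂ) :=
    IntermediateField.finiteDimensional_iSup_of_finite
  haveI hM : FiniteDimensional ℚ M := IntermediateField.finiteDimensional_sup _ _
  let L : IntermediateField ℚ ℂ := normalClosure ℚ M ℂ
  haveI hLfin : FiniteDimensional ℚ L := normalClosure.is_finiteDimensional ℚ M ℂ
  haveI hNC : IsNormalClosure ℚ M L :=
    Algebra.IsAlgebraic.isNormalClosure_normalClosure fun x => IsAlgClosed.splits _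
  haveI : Normal ℚ L := hNC.normal
  haveI : IsGalois ℚ L := IsGalois.mk
  haveI : NumberField L := NumberField.mk
  -- §b the corestrictions of `ι₁` and the `τᵢ` to `L`
  have hML : M ≤ L := IntermediateField.le_normalClosure M
  have h₀L : f₀.fieldRange ≤ L := le_sup_left.trans hML
  have hiL : ∀ i, (f i).fieldRange ≤ L := fun i =>
    (le_iSup (fun i => (f i).fieldRange) i).trans (le_sup_right.trans hML)
  let φ₀ : F →ₐ[ℚ] L := (IntermediateField.inclusion h₀L).comp f₀.equivFieldRange.toAlgHom
  let φ : ∀ i, K i →ₐ[ℚ] L := fun i =>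
    (IntermediateField.inclusion (hiL i)).comp (f i).equivFieldRange.toAlgHom
  have hφ₀ : ∀ x : F, ((φ₀ x : L) : ℂ) = ι₁ x := fun _ => rfl
  have hφ : ∀ (i) (y : K i), ((φ i y : L) : ℂ) = τ i y := fun _ _ => rfl
  -- §c `L` as an `F`-algebra through `φ₀`; Galois and finite over `F` by the tower `ℚ ⊆ F ⊆ L`
  letI : Algebra F L := φ₀.toRingHom.toAlgebra
  have halg : ∀ x : F, algebraMap F L x = φ₀ x := fun _ => rfl
  haveI : IsScalarTower ℚ F L := IsScalarTower.of_algebraMap_eq fun q => by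
    rw [halg, AlgHom.commutes]
  haveI : IsGalois F L := IsGalois.tower_top_of_isGalois ℚ F L
  haveI : FiniteDimensional F L := Module.Finite.of_restrictScalars_finite ℚ F L
  -- §d the embedding `τL := (L ⊆ ℂ)` and the `F`-algebra maps `jᵢ`
  refine ⟨L, inferInstance, inferInstance, inferInstance, inferInstance, inferInstance, (L.val : L →+* ℂ), ?_, ?_⟩
  · ext x
    simp only [RingHom.coe_comp, Function.comp_apply, halg]
    exact hφ₀ x
  · refine ⟨fun i => { (φ i).toRingHom with commutes' := fun x => ?_ }, fun i => ?_⟩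
    · -- `F`-linearity: compare inside `ℂ`
      apply Subtype.ext
      change ((φ i (algebraMap F (K i) x) : L) : ℂ) = ((φ₀ x : L) : ℂ)
      rw [hφ, hφ₀, ← RingHom.comp_apply, hτ]
    · ext y
      exact hφ i y

/-- **The same compositum, recorded Galois over `ℚ` as well** (it IS a normal closure over `ℚ` inside `ℂ`): `L` number field, `IsGalois ℚ L`, an
`F`-algebra with `IsScalarTower ℚ F L`, finite and Galois over `F`, `τL` over `ι₁`, `jᵢ` with `τL ∘ jᵢ = τᵢ`.
[cite: Lang2002, Ch. V §3 and Ch. VI §1 Thm. 1.12 (normal closure; compositum of Galois extensions)] -/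
theorem exists_numberField_isGalois_rat_comp_eq (F : Type) [Field F] [NumberField F] (ι₁ : F →+* ℂ)
    {ι : Type} [Finite ι] (K : ι → Type) [∀ i, Field (K i)] [∀ i, NumberField (K i)] [∀ i, Algebra F (K i)]
    (τ : ∀ i, K i →+* ℂ) (hτ : ∀ i, (τ i).comp (algebraMap F (K i)) = ι₁) :
    ∃ (L : Type) (_ : Field L) (_ : NumberField L) (_ : IsGalois ℚ L) (_ : Algebra F L) (_ : IsScalarTower ℚ F L)
      (_ : FiniteDimensional F L) (_ : IsGalois F L)
      (τL : L →+* ℂ), τL.comp (algebraMap F L) = ι₁ ∧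
        ∃ j : ∀ i, K i →ₐ[F] L, ∀ i, τL.comp (j i : K i →+* L) = τ i := by
  classical
  let f₀ : F →ₐ[ℚ] ℂ := ι₁.toRatAlgHom
  let f : ∀ i, K i →ₐ[ℚ] ℂ := fun i => (τ i).toRatAlgHom
  let M : IntermediateField ℚ ℂ := f₀.fieldRange ⊔ ⨆ i, (f i).fieldRange
  haveI h₀ : FiniteDimensional ℚ f₀.fieldRange := LinearEquiv.finiteDimensional f₀.equivFieldRange.toLinearEquiv
  haveI hᵢ : ∀ i, FiniteDimensional ℚ (f i).fieldRange := fun i =>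
    LinearEquiv.finiteDimensional (f i).equivFieldRange.toLinearEquiv
  haveI : FiniteDimensional ℚ (⨆ i, (f i).fieldRange : IntermediateField ℚ ℂ) :=
    IntermediateField.finiteDimensional_iSup_of_finite
  haveI hM : FiniteDimensional ℚ M := IntermediateField.finiteDimensional_sup _ _
  let L : IntermediateField ℚ ℂ := normalClosure ℚ M ℂ
  haveI hLfin : FiniteDimensional ℚ L := normalClosure.is_finiteDimensional ℚ M ℂ
  haveI hNC : IsNormalClosure ℚ M L :=
    Algebra.IsAlgebraic.isNormalClosure_normalClosure fun x => IsAlgClosed.splits _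
  haveI : Normal ℚ L := hNC.normal
  haveI : IsGalois ℚ L := IsGalois.mk
  haveI : NumberField L := NumberField.mk
  have hML : M ≤ L := IntermediateField.le_normalClosure M
  have h₀L : f₀.fieldRange ≤ L := le_sup_left.trans hML
  have hiL : ∀ i, (f i).fieldRange ≤ L := fun i =>
    (le_iSup (fun i => (f i).fieldRange) i).trans (le_sup_right.trans hML)
  let φ₀ : F →ₐ[ℚ] L := (IntermediateField.inclusion h₀L).comp f₀.equivFieldRange.toAlgHom
  let φ : ∀ i, K i →ₐ[ℚ] L := fun i =>
    (IntermediateField.inclusion (hiL i)).comp (f i).equivFieldRange.toAlgHom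
  have hφ₀ : ∀ x : F, ((φ₀ x : L) : ℂ) = ι₁ x := fun _ => rfl
  have hφ : ∀ (i) (y : K i), ((φ i y : L) : ℂ) = τ i y := fun _ _ => rfl
  letI : Algebra F L := φ₀.toRingHom.toAlgebra
  have halg : ∀ x : F, algebraMap F L x = φ₀ x := fun _ => rfl
  haveI hST : IsScalarTower ℚ F L := IsScalarTower.of_algebraMap_eq fun q => by
    rw [halg, AlgHom.commutes]
  haveI : IsGalois F L := IsGalois.tower_top_of_isGalois ℚ F L
  haveI : FiniteDimensional F L := Module.Finite.of_restrictScalars_finite ℚ F L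
  refine ⟨L, inferInstance, inferInstance, inferInstance, inferInstance, hST, inferInstance, inferInstance,
    (L.val : L →+* ℂ), ?_, ?_⟩
  · ext x
    simp only [RingHom.coe_comp, Function.comp_apply, halg]
    exact hφ₀ x
  · refine ⟨fun i => { (φ i).toRingHom with commutes' := fun x => ?_ }, fun i => ?_⟩
    · apply Subtype.ext
      change ((φ i (algebraMap F (K i) x) : L) : ℂ) = ((φ₀ x : L) : ℂ)
      rw [hφ, hφ₀, ← RingHom.comp_apply, hτ]
    · ext y
      exact hφ i y

end Literature.FieldTheory.Galois

end
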